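import Summits.Ventures.LatticeQCDFlow.Scaling.SimulatedTemperingModeGap
import Summits.Ventures.LatticeQCDFlow.Scaling.TemperingLikelihoodRatio

/-!
HONEST FRAMING: exact (Metropolis-corrected) sampling algorithms for lattice gauge theory; figures
of merit are autocorrelation/cost numbers at stated couplings and volumes; no continuum-physics
claim.

# SimulatedTemperingModeExpFamily — THE GENERIC GUARANTEE FOR TEMPERING IN THE COUPLING OF `w·e^{βX}` ACROSS A WINDOW
# OF WIDTH `W` WITH SPACING `Δ ≤ 1/osc(X)`: `τ_int(g) ≤ 25(K+1)·e^{W·osc(X)}/(γ_A·min{1/(eK), γ₀}) − ½` FOR EVERY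
# OBSERVABLE — POLYNOMIAL IN THE LADDER, EXPONENTIAL ONLY IN WINDOW × OSCILLATION (lean-2 GEN-17, ours)

Venture-side (OURS).  Cell `lqcd-flow` (pub-lqcd), unit `pub-lqcd-lean-2-g17`, 2026-08-25.  Composition of
`Scaling/SimulatedTemperingModeGap` (`τ_int ≤ 25(K+1)/(pγ_A·min{δ/K, γ₀}) − ½` at `t = ½`) with
`Scaling/TemperingLikelihoodRatio` (`δ = e^{−1}` once `ΔR ≤ 1`, `p = e^{−WR}` on a window `KΔ ≤ W`) for levels
`μ_k(x) = w(x)e^{β_k X(x)}/Σ_y w(y)e^{β_k X(y)}` given by HYPOTHESES (no definitions), `|X(x) − X(y)| ≤ R`,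
`|β_{l+1} − β_l| ≤ Δ`.

## What is proved

* `expFamily_sum_one` — the levels are probability vectors.
* **`stFinModeExpFamily_tauInt_le`** — `K ≥ 1`, every mode nonempty, within-level updates row-stochastic,
  `μ_k`-reversible, irreducible, with mode-restricted Poincaré constant `γ_A ∈ (0,1]` at every level and global
  Poincaré constant `γ₀ > 0` at the hot level `0`; `ΔR ≤ 1`, `KΔ ≤ W` ⇒ for every non-constant observable `g` of the
  `t = ½` sampler, `asympVar(g)/(2Var(g)) ≤ 25(K+1)/(e^{−WR}·γ_A·min{e^{−1}/K, γ₀}) − ½`.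

Reading (no numerics implied): the only exponential factor in the generic guarantee is `e^{W·osc(X)}` (persistence);
the ladder enters polynomially (`K(K+1)`), the within-mode and hot-level relaxations linearly.  For an extensive
action `osc(X) ∝ volume`, so a volume-independent guarantee needs either a window `W ∝ 1/volume` or structural
persistence of the modes (sector weights that vary slowly with the coupling) — the latter is model input, NOT CLAIMED.
Literature grade (cell rule): composition of the two files above; nothing cited as a fact; no new bib keys.
-/

noncomputable section

open Finset Real
open Literature.Probability.MarkovChains
open Literature.Probability.MarkovChains.Decomposition

namespace Summit.Ventures.LatticeQCDFlow.Scaling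

variable {S J : Type*} [Fintype S] [DecidableEq S] [Fintype J] [DecidableEq J] {K : ℕ}
  {μ : Fin (K + 1) → S → ℝ} {M : Fin (K + 1) → Matrix S S ℝ} {mode : S → J}
  {w X : S → ℝ} {R Δ W : ℝ} {β : Fin (K + 1) → ℝ}

omit [DecidableEq S] [Fintype J] [DecidableEq J] in
/-- The levels of the family are probability vectors. [ours] -/
theorem expFamily_sum_one (hw : ∀ x, 0 < w x)
    (hμZ : ∀ k x, μ k x = w x * exp (β k * X x) / ∑ y, w y * exp (β k * X y)) [Nonempty S] (k : Fin (K + 1)) :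
    ∑ x, μ k x = 1 := by
  have hZ : 0 < ∑ y, w y * exp (β k * X y) :=
    Finset.sum_pos (fun y _ => mul_pos (hw y) (exp_pos _)) univ_nonempty
  simp_rw [hμZ k, ← Finset.sum_div]
  exact div_self hZ.ne'

/-- **THE GENERIC TEMPERING GUARANTEE FOR AN EXPONENTIAL FAMILY IN THE COUPLING** (`t = ½`): with spacing `ΔR ≤ 1`
on a window `KΔ ≤ W`, within-mode Poincaré constant `γ_A`, hot-level Poincaré constant `γ₀`,
`τ_int(g) ≤ 25(K+1)/(e^{−WR}·γ_A·min{e^{−1}/K, γ₀}) − ½` for every non-constant observable `g`. [ours] -/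
theorem stFinModeExpFamily_tauInt_le [Nonempty S] (hK : 1 ≤ K) (hw : ∀ x, 0 < w x)
    (hX : ∀ x y, |X x - X y| ≤ R)
    (hμZ : ∀ k x, μ k x = w x * exp (β k * X x) / ∑ y, w y * exp (β k * X y))
    (hβ : ∀ l : Fin K, |β l.succ - β l.castSucc| ≤ Δ) (hΔR : Δ * R ≤ 1) (hW : K * Δ ≤ W)
    (hmode : Function.Surjective mode) (hM : ∀ k, IsRowStochastic (M k)) (hMrev : ∀ k, DetailedBalance (μ k) (M k))
    (hMirr : ∀ k, IsIrreducible (M k)) {γ₀ γA : ℝ} (hγ₀ : 0 < γ₀) (hγA : 0 < γA) (hγA1 : γA ≤ 1)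
    (hgap0 : ∀ h : S → ℝ, γ₀ * lawVariance (μ 0) h ≤ dirichletForm (μ 0) (M 0) h)
    (hgapA : ∀ k j, ∀ h : S → ℝ, γA * lawVariance (blockLaw (μ k) mode j) h
      ≤ dirichletForm (blockLaw (μ k) mode j) (restrictionChain (M k) mode) h)
    {g : Fin (K + 1) × S → ℝ} (hg : 0 < lawVariance (stFinLaw μ) g) :
    asympVar g (stFinLaw μ) (stFinSampler (1 / 2) μ M) / (2 * lawVariance (stFinLaw μ) g)
      ≤ 25 * (K + 1) / (exp (-(W * R)) * γA * min (exp (-1) / K) γ₀) - 1 / 2 := by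
  have hK0 : 0 < K := by omega
  obtain ⟨x₀⟩ := ‹Nonempty S›
  have hR : 0 ≤ R := le_trans (abs_nonneg _) (hX x₀ x₀)
  have hΔ : 0 ≤ Δ := le_trans (abs_nonneg _) (hβ ⟨0, hK0⟩)
  have hWR : 0 ≤ W * R := mul_nonneg (le_trans (by positivity) hW) hR
  have hp1 : exp (-(W * R)) ≤ 1 := by rw [exp_le_one_iff]; linarith
  have hδ1 : exp (-1 : ℝ) ≤ 1 := by rw [exp_le_one_iff]; norm_num
  exact stFinModeHalf_tauInt_le (μ := μ) (M := M) (mode := mode) (fun k x => expFamily_pos hw hμZ k x)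
    (expFamily_sum_one hw hμZ) hmode hK hM hMrev hMirr (exp_pos _) hp1 (exp_pos _) hδ1 hγ₀ hγA hγA1
    (fun k l j hkl => expFamily_hpers_window hw hX hμZ hβ mode hK0 hW k l j hkl)
    (fun l j => expFamily_hδ_unit hw hX hμZ hβ mode hK0 hΔR l j) hgap0 hgapA hg

end Summit.Ventures.LatticeQCDFlow.Scaling

end
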